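import Literature.Computability.Cryptography.LWENoiseWidth
import Literature.Algebra.EuclideanLattices.StatDistCompose
import HarnessLib

/-!
# Re-continuising a discretised Gaussian: rounding to the grid `Q⁻¹ℤ` plus a uniform jitter costs `≤ 2/(αQ)`

Topic `Computability/Cryptography` (family `pqc`), grouping namespace `LWE`. An analytic adapter for the
decomposition of `Literature.Computability.Cryptography.blprs_gapSVP_sqrt_dim_to_lwe_classical`
(pqc.S21; also usable by pqc.S19/S20): the oracle interfaces of `LWEHardness.lean` /
`BLPRSReduction.lean` transmit samples with DISCRETISED noise `Ψ̄_α` (`b̄ = ⌊Q b⌉ mod Q`, Regev's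
Lemma 4.3), whereas BLPRS's chain (Thm. 4.1, Cor. 3.2: `LWEModulusSwitchSamples.lean`) is written for the
continuous `Ψ_α = D_α mod 1`. A reduction receiving `b̄` can only put the sample back at a uniformly
random point of its grid cell, `b' = (b̄ + u)/Q`, `u ← U[-1/2,1/2)`. This file PROVES that for the noise
itself this changes the law by at most `2/(αQ)` in statistical distance — negligible in BLPRS's regime
(dimension `k = √n`, modulus `Q = 2^{k/2}`, `α ≥ 1/poly`). No named fact; the `def`s are the grid cells,
the jitter map and bookkeeping constants.

## The estimate

For `x ← D_α` (density `p_α(x) = α⁻¹e^{-πx²/α²}`) and an independent `u ← U[-1/2,1/2)`, the law of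
`(⌊Qx⌉ + u)/Q` has the cell-averaged density `p̃(y) = Q ∫_{cell(y)} p_α`. On each cell
`C_k = [(k-1/2)/Q, (k+1/2)/Q)` both `D_α(A ∩ C_k)` and `D_α(C_k)·Q·vol(A ∩ C_k)` lie between
`p_α(far_k)·vol(A ∩ C_k)` and `p_α(near_k)·vol(A ∩ C_k)` (`near_k`/`far_k` the points of `C̄_k` nearest
to / farthest from `0`; `p_α` is radially decreasing), so they differ by at most
`(p_α(near_k) - p_α(far_k))/Q`; and `∑_k (p_α(near_k) - p_α(far_k))` telescopes on each half-line to
`p_α(0) + p_α(1/(2Q)) ≤ 2p_α(0) = 2/α`. Hence `|Pr[(⌊Qx⌉+u)/Q ∈ A] - Pr[x ∈ A]| ≤ 2/(αQ)` for every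
measurable `A`.

## Results

* `cellIndex Q x = ⌊Qx⌉`, `cellIndex_eq_iff` / `preimage_cellIndex_singleton` (the cells), `volume_cell`
  (`= 1/Q`), `abs_bounds_of_cellIndex_eq` (`max(|k|-1/2,0) ≤ Q|x| ≤ |k|+1/2` on `C_k`).
* `widthDensity α = p_α` (the tree's `gaussianPDFReal_width`), `widthDensity_le_of_abs_le` (radially
  decreasing), `gaussianReal_width_apply` (`D_α(S) = ∫_S p_α`).
* `unitUniform = U[-1/2,1/2)`, `jitter Q (x,u) = (⌊Qx⌉+u)/Q`, `unitUniform_jitter_fibre`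
  (`Pr_u[(k+u)/Q ∈ A] = Q·vol(A ∩ C_k)`), **`jitterLaw_apply`** (the law of the jittered variable for ANY
  law of `x`: `∑_k μ(C_k)·Q·vol(A ∩ C_k)`), `measure_eq_tsum_inter_cell`.
* `gNear`, `gFar`, `gaussian_le_gNear_mul`, `gFar_mul_le_gaussian` (the cell bounds), `cellOsc`,
  `cell_compare` (the two one-sided cell comparisons), `tsum_ofReal_gNear_sub_gFar_le` (**the telescoping
  bound `≤ 2/α`**), `tsum_cellOsc_le` (`≤ 2/(αQ)`).
* **`abs_jitterLaw_real_sub_le`** and **`statDist_jitterLaw_gaussian_le`**: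
  `Δ(law of (⌊Qx⌉+u)/Q, D_α) ≤ 2/(αQ)`.

## What is NOT here (next file)

The sample-level packaging on `ℤ_Qⁿ × ℤ_Q → ℤ_Qⁿ × 𝕋` (`(a, b̄) ↦ (a, (b̄ + u)/Q mod 1)`): a uniform
discrete sample becomes EXACTLY a uniform torus sample, and `A_{s,Ψ̄_α}` becomes `A_{s,φ̃}` with
`Δ(φ̃, Ψ_α) ≤ 2/(αQ)` by this file and data processing (`mod 1`).

## References

* O. Regev, *On lattices, learning with errors, random linear codes, and cryptography*, J. ACM 56
  (2009), §2 (`Ψ_α`, its density `α⁻¹e^{-π(x/α)²}`, `Ψ̄_α`), Lemma 4.3 [RegevLWE2009].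
* Z. Brakerski, A. Langlois, C. Peikert, O. Regev, D. Stehlé, *Classical hardness of learning with
  errors*, STOC 2013, p. 13 (the chain in dimension `√n` with `q = 2^{√n/2}`) [BrakerskiEtAl2013].
-/

noncomputable section

open MeasureTheory ProbabilityTheory Literature.Algebra.EuclideanLattices
open scoped ENNReal NNReal Real

namespace Literature.Computability.Cryptography

namespace LWE

variable (Q : ℕ) [NeZero Q]

/-! ### Cells of the grid `Q⁻¹ℤ` -/

/-- The index of the grid cell of `x`: `⌊Q x⌉` (so `discretize Q x = cellIndex Q x mod Q`). [folklore] -/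
def cellIndex (x : ℝ) : ℤ := round ((Q : ℝ) * x)

omit [NeZero Q] in
/-- `cellIndex` is measurable. [folklore] -/
theorem measurable_cellIndex : Measurable (cellIndex Q) := by
  have hround : Measurable (round : ℝ → ℤ) := by
    have : (round : ℝ → ℤ) = fun x => ⌊x + 1 / 2⌋ := funext round_eq
    rw [this]
    exact Int.measurable_floor.comp (measurable_id.add_const _)
  exact hround.comp (measurable_const.mul measurable_id)

/-- The cell of index `k` is `[(k - 1/2)/Q, (k + 1/2)/Q)`. [folklore] -/
theorem cellIndex_eq_iff (x : ℝ) (k : ℤ) :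
    cellIndex Q x = k ↔ x ∈ Set.Ico (((k : ℝ) - 1 / 2) / Q) (((k : ℝ) + 1 / 2) / Q) := by
  have hQ : (0 : ℝ) < Q := by exact_mod_cast Nat.pos_of_ne_zero (NeZero.ne Q)
  rw [cellIndex, round_eq_iff, Set.mem_Ico, Set.mem_Ico, div_le_iff₀ hQ, lt_div_iff₀ hQ, mul_comm x]

/-- The cell of index `k` as a set. [folklore] -/
theorem preimage_cellIndex_singleton (k : ℤ) :
    cellIndex Q ⁻¹' {k} = Set.Ico (((k : ℝ) - 1 / 2) / Q) (((k : ℝ) + 1 / 2) / Q) := by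
  ext x
  exact cellIndex_eq_iff Q x k

/-- Cells are measurable. [folklore] -/
theorem measurableSet_cell (k : ℤ) : MeasurableSet (cellIndex Q ⁻¹' {k}) := by
  rw [preimage_cellIndex_singleton]
  exact measurableSet_Ico

/-- Each cell has Lebesgue measure `1/Q`. [folklore] -/
theorem volume_cell (k : ℤ) : volume (cellIndex Q ⁻¹' {k}) = ENNReal.ofReal (1 / Q) := by
  rw [preimage_cellIndex_singleton, Real.volume_Ico]
  congr 1
  ring

/-- `ofReal (1/Q) · Q = 1` in `ℝ≥0∞`. [folklore] -/
theorem ofReal_one_div_mul_natCast : ENNReal.ofReal (1 / (Q : ℝ)) * (Q : ℝ≥0∞) = 1 := by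
  have hQ : (0 : ℝ) < Q := by exact_mod_cast Nat.pos_of_ne_zero (NeZero.ne Q)
  rw [one_div, ENNReal.ofReal_inv_of_pos hQ, ENNReal.ofReal_natCast,
    ENNReal.inv_mul_cancel (by exact_mod_cast NeZero.ne Q) (ENNReal.natCast_ne_top _)]

/-- On the cell of index `k`: `max(|k| - 1/2, 0) ≤ Q|x| ≤ |k| + 1/2`. [folklore] -/
theorem abs_bounds_of_cellIndex_eq {x : ℝ} {k : ℤ} (h : cellIndex Q x = k) :
    max (|(k : ℝ)| - 1 / 2) 0 ≤ Q * |x| ∧ (Q : ℝ) * |x| ≤ |(k : ℝ)| + 1 / 2 := by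
  have hQ : (0 : ℝ) < Q := by exact_mod_cast Nat.pos_of_ne_zero (NeZero.ne Q)
  rw [cellIndex_eq_iff] at h
  obtain ⟨h1, h2⟩ := h
  rw [div_le_iff₀ hQ] at h1
  rw [lt_div_iff₀ hQ] at h2
  -- `h1 : k - 1/2 ≤ x * Q`, `h2 : x * Q < k + 1/2`
  rcases lt_trichotomy k 0 with hk | hk | hk
  · have hk1 : k ≤ -1 := by omega
    have hk' : (k : ℝ) ≤ -1 := by exact_mod_cast hk1
    have hx : x < 0 := by nlinarith
    rw [abs_of_neg hx, abs_of_neg (by linarith : (k : ℝ) < 0), max_eq_left (by linarith)]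
    constructor <;> nlinarith
  · subst hk
    simp only [Int.cast_zero, abs_zero, zero_sub, zero_add]
    rw [max_eq_right (by norm_num)]
    refine ⟨by positivity, ?_⟩
    rw [Int.cast_zero] at h1 h2
    rcases le_or_gt 0 x with hx | hx
    · rw [abs_of_nonneg hx]; nlinarith
    · rw [abs_of_neg hx]; nlinarith
  · have hk1 : 1 ≤ k := by omega
    have hk' : (1 : ℝ) ≤ k := by exact_mod_cast hk1
    have hx : 0 < x := by nlinarith
    rw [abs_of_pos hx, abs_of_pos (by linarith : (0 : ℝ) < k), max_eq_left (by linarith)]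
    constructor <;> nlinarith

/-! ### The Gaussian density in the tree's normalisation and its monotonicity -/

/-- The density of `D_α = N(0, α²/(2π))`: `p_α(x) = α⁻¹ exp(-π x²/α²)` (the tree's `gaussianPDFReal_width`).
[cite: RegevLWE2009, §2 ("the density of `Ψ_α`'s lift is `α⁻¹ exp(-π(x/α)²)`")] -/
def widthDensity (α x : ℝ) : ℝ := α⁻¹ * Real.exp (-(Real.pi * x ^ 2 / α ^ 2))

/-- `p_α ≥ 0`. [folklore] -/
theorem widthDensity_nonneg {α : ℝ} (hα : 0 < α) (x : ℝ) : 0 ≤ widthDensity α x :=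
  mul_nonneg (inv_nonneg.2 hα.le) (Real.exp_nonneg _)

/-- `p_α` is radially decreasing: `|y| ≤ |x| → p_α(x) ≤ p_α(y)`. [folklore] -/
theorem widthDensity_le_of_abs_le {α : ℝ} (hα : 0 < α) {x y : ℝ} (h : |y| ≤ |x|) :
    widthDensity α x ≤ widthDensity α y := by
  unfold widthDensity
  refine mul_le_mul_of_nonneg_left (Real.exp_le_exp.2 ?_) (inv_nonneg.2 hα.le)
  have : y ^ 2 ≤ x ^ 2 := sq_le_sq.2 h
  have hpos : 0 < α ^ 2 := by positivity
  apply neg_le_neg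
  exact div_le_div_of_nonneg_right (mul_le_mul_of_nonneg_left this Real.pi_pos.le) hpos.le

/-- `D_α(S) = ∫_S p_α` in `ℝ≥0∞`. [folklore] -/
theorem gaussianReal_width_apply {α : ℝ} (hα : 0 < α) (S : Set ℝ) :
    gaussianReal 0 (widthVar α) S = ∫⁻ x in S, ENNReal.ofReal (widthDensity α x) := by
  have hv : widthVar α ≠ 0 := by
    rw [widthVar, ne_eq, Real.toNNReal_eq_zero, not_le]; positivity
  rw [gaussianReal_apply _ hv]
  refine lintegral_congr fun x => ?_
  rw [gaussianPDF, gaussianPDFReal_width hα]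
  rfl

/-! ### The jitter: a uniform point of the cell of `x` -/

/-- The uniform law on `[-1/2, 1/2)` (Lebesgue measure restricted; total mass one). [folklore] -/
def unitUniform : Measure ℝ := volume.restrict (Set.Ico (-(1 / 2 : ℝ)) (1 / 2))

/-- `U[-1/2, 1/2)` is a probability measure. [folklore] -/
instance isProbabilityMeasure_unitUniform : IsProbabilityMeasure unitUniform := by
  constructor
  rw [unitUniform, Measure.restrict_apply_univ, Real.volume_Ico]
  norm_num

/-- **The re-continuisation map**: `(x, u) ↦ (⌊Q x⌉ + u)/Q` — round `x` to the grid `Q⁻¹ℤ` (all that a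
discretised sample remembers) and put it back at a uniformly random point of its cell. [folklore] -/
def jitter (p : ℝ × ℝ) : ℝ := ((cellIndex Q p.1 : ℝ) + p.2) / Q

omit [NeZero Q] in
/-- `jitter` is measurable. [folklore] -/
theorem measurable_jitter : Measurable (jitter Q) := by
  unfold jitter
  refine Measurable.div_const (Measurable.add ?_ measurable_snd) _
  exact (measurable_from_top (f := fun k : ℤ => (k : ℝ))).comp ((measurable_cellIndex Q).comp measurable_fst)

omit [NeZero Q] in
/-- Measurability of the fibre sets `{u | (k + u)/Q ∈ A}`. [folklore] -/
theorem measurableSet_jitter_fibre (k : ℤ) {A : Set ℝ} (hA : MeasurableSet A) :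
    MeasurableSet {u : ℝ | ((k : ℝ) + u) / Q ∈ A} :=
  ((measurable_const_add (k : ℝ)).div_const _) hA

/-- **The fibre of the jitter**: for a cell index `k`, the `u ∈ [-1/2,1/2)` with `(k + u)/Q ∈ A` have
measure `Q · vol(A ∩ cell_k)` (the affine map `u ↦ (k+u)/Q` carries `[-1/2,1/2)` onto the cell and
scales Lebesgue measure by `1/Q`). [folklore] -/
theorem unitUniform_jitter_fibre (k : ℤ) {A : Set ℝ} (hA : MeasurableSet A) :
    unitUniform {u : ℝ | ((k : ℝ) + u) / Q ∈ A} = (Q : ℝ≥0∞) * volume (A ∩ cellIndex Q ⁻¹' {k}) := by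
  have hQ : (0 : ℝ) < Q := by exact_mod_cast Nat.pos_of_ne_zero (NeZero.ne Q)
  rw [unitUniform, Measure.restrict_apply (measurableSet_jitter_fibre Q k hA)]
  have hset : {u : ℝ | ((k : ℝ) + u) / Q ∈ A} ∩ Set.Ico (-(1 / 2 : ℝ)) (1 / 2) =
      (fun u : ℝ => (k : ℝ) + u) ⁻¹' ((fun y : ℝ => (Q : ℝ)⁻¹ * y) ⁻¹' (A ∩ cellIndex Q ⁻¹' {k})) := by
    ext u
    simp only [Set.mem_inter_iff, Set.mem_setOf_eq, Set.mem_preimage, Set.mem_singleton_iff,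
      cellIndex_eq_iff, Set.mem_Ico, inv_mul_eq_div]
    rw [div_le_div_iff_of_pos_right hQ, div_lt_div_iff_of_pos_right hQ]
    constructor
    · rintro ⟨hmem, h1, h2⟩
      exact ⟨hmem, by linarith, by linarith⟩
    · rintro ⟨hmem, h1, h2⟩
      exact ⟨hmem, by linarith, by linarith⟩
  rw [hset, measure_preimage_add, Real.volume_preimage_mul_left (inv_ne_zero hQ.ne'), inv_inv,
    abs_of_pos hQ, ENNReal.ofReal_natCast]

/-- **The law of the re-continuised variable**: for any law `μ` of `x` and an independent `u ← U[-1/2,1/2)`,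
`Pr[(⌊Qx⌉ + u)/Q ∈ A] = ∑_k μ(cell_k) · Q · vol(A ∩ cell_k)` (a piecewise-constant, cell-averaged version
of `μ`). [folklore] -/
theorem jitterLaw_apply (μ : Measure ℝ) [SFinite μ] {A : Set ℝ} (hA : MeasurableSet A) :
    ((μ.prod unitUniform).map (jitter Q)) A =
      ∑' k : ℤ, μ (cellIndex Q ⁻¹' {k}) * ((Q : ℝ≥0∞) * volume (A ∩ cellIndex Q ⁻¹' {k})) := by
  rw [Measure.map_apply (measurable_jitter Q) hA, Measure.prod_apply ((measurable_jitter Q) hA)]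
  set F : ℤ → ℝ≥0∞ := fun k => (Q : ℝ≥0∞) * volume (A ∩ cellIndex Q ⁻¹' {k}) with hF
  have hint : ∀ x : ℝ, unitUniform (Prod.mk x ⁻¹' (jitter Q ⁻¹' A)) = F (cellIndex Q x) := by
    intro x
    have hx : Prod.mk x ⁻¹' (jitter Q ⁻¹' A) = {u : ℝ | (((cellIndex Q x : ℤ) : ℝ) + u) / Q ∈ A} := rfl
    rw [hx, unitUniform_jitter_fibre Q _ hA]
  simp_rw [hint]
  rw [← lintegral_map (measurable_from_top (f := F)) (measurable_cellIndex Q), lintegral_countable']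
  refine tsum_congr fun k => ?_
  rw [Measure.map_apply (measurable_cellIndex Q) (measurableSet_singleton k), mul_comm]

omit [NeZero Q] in
/-- Any measure of a set is the sum over the cells. [folklore] -/
theorem measure_eq_tsum_inter_cell (μ : Measure ℝ) {A : Set ℝ} (hA : MeasurableSet A) :
    μ A = ∑' k : ℤ, μ (A ∩ cellIndex Q ⁻¹' {k}) := by
  have hdecomp : A = ⋃ k : ℤ, A ∩ cellIndex Q ⁻¹' {k} := by
    ext x
    simp
  conv_lhs => rw [hdecomp]
  rw [measure_iUnion]
  · intro i j hij
    refine Set.disjoint_left.2 fun x hxi hxj => hij ?_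
    have h1 : cellIndex Q x = i := hxi.2
    have h2 : cellIndex Q x = j := hxj.2
    rw [← h1, ← h2]
  · exact fun k => hA.inter ((measurable_cellIndex Q) (measurableSet_singleton k))

/-! ### Cellwise comparison with a Gaussian law -/

/-- The value of `p_α` at the point of (the closure of) cell `k` nearest to `0`. [folklore] -/
def gNear (α : ℝ) (k : ℤ) : ℝ := widthDensity α (max (|(k : ℝ)| - 1 / 2) 0 / Q)

/-- The value of `p_α` at the point of the closure of cell `k` farthest from `0`. [folklore] -/
def gFar (α : ℝ) (k : ℤ) : ℝ := widthDensity α ((|(k : ℝ)| + 1 / 2) / Q)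

/-- `p_α(far_k) ≤ p_α(near_k)`. [folklore] -/
theorem gFar_le_gNear {α : ℝ} (hα : 0 < α) (k : ℤ) : gFar Q α k ≤ gNear Q α k := by
  have hQ : (0 : ℝ) < Q := by exact_mod_cast Nat.pos_of_ne_zero (NeZero.ne Q)
  refine widthDensity_le_of_abs_le hα ?_
  have h1 : 0 ≤ max (|(k : ℝ)| - 1 / 2) 0 / Q := by positivity
  have h2 : 0 ≤ (|(k : ℝ)| + 1 / 2) / Q := by positivity
  rw [abs_of_nonneg h1, abs_of_nonneg h2]
  exact div_le_div_of_nonneg_right (max_le (by linarith [abs_nonneg (k : ℝ)]) (by positivity)) hQ.le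

/-- **Upper cell bound**: on a measurable `S ⊆ cell_k`, `D_α(S) ≤ p_α(near_k) · vol(S)`. [folklore] -/
theorem gaussian_le_gNear_mul {α : ℝ} (hα : 0 < α) (k : ℤ) {S : Set ℝ} (hS : MeasurableSet S)
    (hSk : S ⊆ cellIndex Q ⁻¹' {k}) :
    gaussianReal 0 (widthVar α) S ≤ ENNReal.ofReal (gNear Q α k) * volume S := by
  have hQ : (0 : ℝ) < Q := by exact_mod_cast Nat.pos_of_ne_zero (NeZero.ne Q)
  rw [gaussianReal_width_apply hα, ← setLIntegral_const]
  refine setLIntegral_mono' hS fun x hx => ENNReal.ofReal_le_ofReal (widthDensity_le_of_abs_le hα ?_)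
  have hb := (abs_bounds_of_cellIndex_eq Q (hSk hx)).1
  have h1 : 0 ≤ max (|(k : ℝ)| - 1 / 2) 0 / Q := by positivity
  rw [abs_of_nonneg h1, div_le_iff₀ hQ, mul_comm]
  exact hb

/-- **Lower cell bound**: on a measurable `S ⊆ cell_k`, `p_α(far_k) · vol(S) ≤ D_α(S)`. [folklore] -/
theorem gFar_mul_le_gaussian {α : ℝ} (hα : 0 < α) (k : ℤ) {S : Set ℝ} (hS : MeasurableSet S)
    (hSk : S ⊆ cellIndex Q ⁻¹' {k}) :
    ENNReal.ofReal (gFar Q α k) * volume S ≤ gaussianReal 0 (widthVar α) S := by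
  have hQ : (0 : ℝ) < Q := by exact_mod_cast Nat.pos_of_ne_zero (NeZero.ne Q)
  rw [gaussianReal_width_apply hα, ← setLIntegral_const]
  refine setLIntegral_mono' hS fun x hx => ENNReal.ofReal_le_ofReal (widthDensity_le_of_abs_le hα ?_)
  have hb := (abs_bounds_of_cellIndex_eq Q (hSk hx)).2
  have h2 : 0 ≤ (|(k : ℝ)| + 1 / 2) / Q := by positivity
  rw [abs_of_nonneg h2, le_div_iff₀ hQ, mul_comm]
  exact hb

/-- The oscillation weight of cell `k`: `(p_α(near_k) - p_α(far_k)) / Q`. [folklore] -/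
def cellOsc (α : ℝ) (k : ℤ) : ℝ≥0∞ := ENNReal.ofReal (gNear Q α k - gFar Q α k) * ENNReal.ofReal (1 / Q)

/-- **Cellwise comparison** of the cell-averaged Gaussian with the Gaussian: with
`a_k = D_α(cell_k) · Q · vol(A ∩ cell_k)` and `b_k = D_α(A ∩ cell_k)`, both `a_k ≤ b_k + osc_k` and
`b_k ≤ a_k + osc_k`. [folklore] -/
theorem cell_compare {α : ℝ} (hα : 0 < α) (k : ℤ) {A : Set ℝ} (hA : MeasurableSet A) :
    gaussianReal 0 (widthVar α) (cellIndex Q ⁻¹' {k}) * ((Q : ℝ≥0∞) * volume (A ∩ cellIndex Q ⁻¹' {k})) ≤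
        gaussianReal 0 (widthVar α) (A ∩ cellIndex Q ⁻¹' {k}) + cellOsc Q α k ∧
      gaussianReal 0 (widthVar α) (A ∩ cellIndex Q ⁻¹' {k}) ≤
        gaussianReal 0 (widthVar α) (cellIndex Q ⁻¹' {k}) * ((Q : ℝ≥0∞) * volume (A ∩ cellIndex Q ⁻¹' {k})) +
          cellOsc Q α k := by
  set μ := gaussianReal 0 (widthVar α) with hμ
  set C := cellIndex Q ⁻¹' {k} with hC
  set lam := volume (A ∩ C) with hlam
  have hCm : MeasurableSet C := measurableSet_cell Q k
  have hACm : MeasurableSet (A ∩ C) := hA.inter hCm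
  have hsub : A ∩ C ⊆ C := Set.inter_subset_right
  have hlam_le : lam ≤ ENNReal.ofReal (1 / Q) := by
    rw [hlam, ← volume_cell Q k]; exact measure_mono hsub
  have hnear0 : 0 ≤ gNear Q α k := widthDensity_nonneg hα _
  have hfar0 : 0 ≤ gFar Q α k := widthDensity_nonneg hα _
  have hfn := gFar_le_gNear Q hα k
  have hsplit : ENNReal.ofReal (gNear Q α k) =
      ENNReal.ofReal (gFar Q α k) + ENNReal.ofReal (gNear Q α k - gFar Q α k) := by
    rw [← ENNReal.ofReal_add hfar0 (by linarith)]
    congr 1; ring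
  -- the four cell bounds
  have hCup : μ C ≤ ENNReal.ofReal (gNear Q α k) * ENNReal.ofReal (1 / Q) := by
    rw [← volume_cell Q k]; exact gaussian_le_gNear_mul Q hα k hCm le_rfl
  have hClo : ENNReal.ofReal (gFar Q α k) * ENNReal.ofReal (1 / Q) ≤ μ C := by
    rw [← volume_cell Q k]; exact gFar_mul_le_gaussian Q hα k hCm le_rfl
  have hAup : μ (A ∩ C) ≤ ENNReal.ofReal (gNear Q α k) * lam := gaussian_le_gNear_mul Q hα k hACm hsub
  have hAlo : ENNReal.ofReal (gFar Q α k) * lam ≤ μ (A ∩ C) := gFar_mul_le_gaussian Q hα k hACm hsub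
  have hosc : ENNReal.ofReal (gNear Q α k - gFar Q α k) * lam ≤ cellOsc Q α k :=
    mul_le_mul_right hlam_le _
  constructor
  · calc μ C * ((Q : ℝ≥0∞) * lam)
        ≤ ENNReal.ofReal (gNear Q α k) * ENNReal.ofReal (1 / Q) * ((Q : ℝ≥0∞) * lam) :=
          mul_le_mul_left hCup _
      _ = ENNReal.ofReal (gNear Q α k) * lam := by
          rw [mul_assoc, ← mul_assoc (ENNReal.ofReal (1 / (Q : ℝ))), ofReal_one_div_mul_natCast, one_mul]
      _ = ENNReal.ofReal (gFar Q α k) * lam + ENNReal.ofReal (gNear Q α k - gFar Q α k) * lam := by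
          rw [hsplit, add_mul]
      _ ≤ μ (A ∩ C) + cellOsc Q α k := add_le_add hAlo hosc
  · calc μ (A ∩ C) ≤ ENNReal.ofReal (gNear Q α k) * lam := hAup
      _ = ENNReal.ofReal (gFar Q α k) * lam + ENNReal.ofReal (gNear Q α k - gFar Q α k) * lam := by
          rw [hsplit, add_mul]
      _ ≤ μ C * ((Q : ℝ≥0∞) * lam) + cellOsc Q α k := by
          refine add_le_add ?_ hosc
          calc ENNReal.ofReal (gFar Q α k) * lam
              = ENNReal.ofReal (gFar Q α k) * ENNReal.ofReal (1 / Q) * ((Q : ℝ≥0∞) * lam) := by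
                rw [mul_assoc, ← mul_assoc (ENNReal.ofReal (1 / (Q : ℝ))), ofReal_one_div_mul_natCast, one_mul]
            _ ≤ μ C * ((Q : ℝ≥0∞) * lam) := mul_le_mul_left hClo _

/-! ### The oscillation sum telescopes to at most `2 p_α(0) = 2/α` -/

/-- `p_α` at the grid half-points `(j + 1/2)/Q`, `j ≥ 0`. [folklore] -/
def halfPoint (α : ℝ) (j : ℕ) : ℝ := widthDensity α (((j : ℝ) + 1 / 2) / Q)

/-- The half-point values decrease. [folklore] -/
theorem halfPoint_succ_le {α : ℝ} (hα : 0 < α) (j : ℕ) : halfPoint Q α (j + 1) ≤ halfPoint Q α j := by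
  have hQ : (0 : ℝ) < Q := by exact_mod_cast Nat.pos_of_ne_zero (NeZero.ne Q)
  refine widthDensity_le_of_abs_le hα ?_
  rw [abs_of_nonneg (by positivity), abs_of_nonneg (by positivity)]
  push_cast
  exact div_le_div_of_nonneg_right (by linarith) hQ.le

/-- A telescoping series of nonnegative differences is at most its first term. [folklore] -/
theorem tsum_ofReal_sub_succ_le {e : ℕ → ℝ} (he : ∀ j, e (j + 1) ≤ e j) (he0 : ∀ j, 0 ≤ e j) :
    ∑' j, ENNReal.ofReal (e j - e (j + 1)) ≤ ENNReal.ofReal (e 0) := by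
  refine ENNReal.tsum_le_of_sum_range_le fun N => ?_
  rw [← ENNReal.ofReal_sum_of_nonneg fun j _ => sub_nonneg.2 (he j), Finset.sum_range_sub']
  exact ENNReal.ofReal_le_ofReal (by linarith [he0 N])

omit [NeZero Q] in
/-- `near_{n+1} = (n + 1/2)/Q`. [folklore] -/
theorem gNear_natCast_succ (α : ℝ) (n : ℕ) : gNear Q α ((n + 1 : ℕ) : ℤ) = halfPoint Q α n := by
  unfold gNear halfPoint
  have hc : (((n + 1 : ℕ) : ℤ) : ℝ) = n + 1 := by push_cast; ring
  rw [hc, abs_of_nonneg (by positivity), max_eq_left (by linarith)]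
  congr 1; ring

omit [NeZero Q] in
/-- `far_{n+1} = (n + 3/2)/Q`. [folklore] -/
theorem gFar_natCast_succ (α : ℝ) (n : ℕ) : gFar Q α ((n + 1 : ℕ) : ℤ) = halfPoint Q α (n + 1) := by
  unfold gFar halfPoint
  have hc : (((n + 1 : ℕ) : ℤ) : ℝ) = n + 1 := by push_cast; ring
  rw [hc, abs_of_nonneg (by positivity)]
  push_cast
  ring_nf

omit [NeZero Q] in
/-- `near_{-(n+1)} = (n + 1/2)/Q` in absolute value. [folklore] -/
theorem gNear_negSucc (α : ℝ) (n : ℕ) : gNear Q α (-((n : ℤ) + 1)) = halfPoint Q α n := by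
  unfold gNear halfPoint
  have hc : |((-((n : ℤ) + 1) : ℤ) : ℝ)| = n + 1 := by
    push_cast
    rw [abs_of_nonpos (by linarith [(Nat.cast_nonneg n : (0 : ℝ) ≤ n)])]
    ring
  rw [hc, max_eq_left (by linarith)]
  congr 1; ring

omit [NeZero Q] in
/-- `far_{-(n+1)} = (n + 3/2)/Q` in absolute value. [folklore] -/
theorem gFar_negSucc (α : ℝ) (n : ℕ) : gFar Q α (-((n : ℤ) + 1)) = halfPoint Q α (n + 1) := by
  unfold gFar halfPoint
  have hc : |((-((n : ℤ) + 1) : ℤ) : ℝ)| = n + 1 := by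
    push_cast
    rw [abs_of_nonpos (by linarith [(Nat.cast_nonneg n : (0 : ℝ) ≤ n)])]
    ring
  rw [hc]
  push_cast
  ring_nf

omit [NeZero Q] in
/-- `near_0 = 0`. [folklore] -/
theorem gNear_zero (α : ℝ) : gNear Q α 0 = widthDensity α 0 := by
  unfold gNear
  rw [Int.cast_zero, abs_zero, max_eq_right (by norm_num), zero_div]

omit [NeZero Q] in
/-- `far_0 = 1/(2Q)`. [folklore] -/
theorem gFar_zero (α : ℝ) : gFar Q α 0 = halfPoint Q α 0 := by
  unfold gFar halfPoint
  rw [Int.cast_zero, abs_zero, Nat.cast_zero]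

/-- **The oscillations sum to at most `2/α`** (`∑_k (p_α(near_k) - p_α(far_k)) ≤ p_α(0) + p_α(1/(2Q)) ≤ 2p_α(0)`
by telescoping on each half-line). [folklore] -/
theorem tsum_ofReal_gNear_sub_gFar_le {α : ℝ} (hα : 0 < α) :
    ∑' k : ℤ, ENNReal.ofReal (gNear Q α k - gFar Q α k) ≤ ENNReal.ofReal (2 / α) := by
  set f : ℤ → ℝ≥0∞ := fun k => ENNReal.ofReal (gNear Q α k - gFar Q α k) with hf
  have he_anti : ∀ j, halfPoint Q α (j + 1) ≤ halfPoint Q α j := halfPoint_succ_le Q hα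
  have he0 : ∀ j, 0 ≤ halfPoint Q α j := fun j => widthDensity_nonneg hα _
  -- split the sum over `ℤ` into `0`, the positive and the negative integers
  rw [tsum_of_nat_of_neg_add_one (f := f) ENNReal.summable ENNReal.summable,
    tsum_eq_zero_add' (f := fun n : ℕ => f n) ENNReal.summable]
  have h0 : f ((0 : ℕ) : ℤ) = ENNReal.ofReal (widthDensity α 0 - halfPoint Q α 0) := by
    rw [hf]; simp only [Nat.cast_zero]; rw [gNear_zero, gFar_zero]
  have h1 : ∑' n : ℕ, f ((n + 1 : ℕ) : ℤ) ≤ ENNReal.ofReal (halfPoint Q α 0) := by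
    have : ∀ n : ℕ, f ((n + 1 : ℕ) : ℤ) = ENNReal.ofReal (halfPoint Q α n - halfPoint Q α (n + 1)) := by
      intro n; rw [hf]; simp only []; rw [gNear_natCast_succ, gFar_natCast_succ]
    simp_rw [this]
    exact tsum_ofReal_sub_succ_le he_anti he0
  have h2 : ∑' n : ℕ, f (-((n : ℤ) + 1)) ≤ ENNReal.ofReal (halfPoint Q α 0) := by
    have : ∀ n : ℕ, f (-((n : ℤ) + 1)) = ENNReal.ofReal (halfPoint Q α n - halfPoint Q α (n + 1)) := by
      intro n; rw [hf]; simp only []; rw [gNear_negSucc, gFar_negSucc]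
    simp_rw [this]
    exact tsum_ofReal_sub_succ_le he_anti he0
  have hwd0 : widthDensity α 0 = α⁻¹ := by simp [widthDensity]
  have he0le : halfPoint Q α 0 ≤ widthDensity α 0 := by
    rw [halfPoint]
    exact widthDensity_le_of_abs_le hα (by rw [abs_zero]; exact abs_nonneg _)
  calc f ((0 : ℕ) : ℤ) + ∑' n : ℕ, f ((n + 1 : ℕ) : ℤ) + ∑' n : ℕ, f (-((n : ℤ) + 1))
      ≤ ENNReal.ofReal (widthDensity α 0 - halfPoint Q α 0) + ENNReal.ofReal (halfPoint Q α 0) +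
          ENNReal.ofReal (halfPoint Q α 0) := by
        rw [h0]; exact add_le_add (add_le_add le_rfl h1) h2
    _ = ENNReal.ofReal (widthDensity α 0 + halfPoint Q α 0) := by
        rw [← ENNReal.ofReal_add (by linarith) (he0 0), ← ENNReal.ofReal_add (by linarith [he0 0]) (he0 0)]
        congr 1; ring
    _ ≤ ENNReal.ofReal (2 / α) := ENNReal.ofReal_le_ofReal (by
        have h2 : 2 / α = α⁻¹ + α⁻¹ := by ring
        rw [hwd0] at he0le ⊢; linarith)

/-- Hence `∑_k osc_k ≤ 2/(αQ)`. [folklore] -/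
theorem tsum_cellOsc_le {α : ℝ} (hα : 0 < α) : ∑' k : ℤ, cellOsc Q α k ≤ ENNReal.ofReal (2 / (α * Q)) := by
  have hQ : (0 : ℝ) < Q := by exact_mod_cast Nat.pos_of_ne_zero (NeZero.ne Q)
  simp only [cellOsc]
  rw [ENNReal.tsum_mul_right]
  calc (∑' k : ℤ, ENNReal.ofReal (gNear Q α k - gFar Q α k)) * ENNReal.ofReal (1 / Q)
      ≤ ENNReal.ofReal (2 / α) * ENNReal.ofReal (1 / Q) := mul_le_mul_left (tsum_ofReal_gNear_sub_gFar_le Q hα) _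
    _ = ENNReal.ofReal (2 / (α * Q)) := by
        rw [← ENNReal.ofReal_mul (by positivity)]
        congr 1; field_simp

/-! ### The bound -/

/-- The re-continuised law is a probability measure. [folklore] -/
instance isProbabilityMeasure_jitterLaw (μ : Measure ℝ) [IsProbabilityMeasure μ] :
    IsProbabilityMeasure ((μ.prod unitUniform).map (jitter Q)) :=
  Measure.isProbabilityMeasure_map (measurable_jitter Q).aemeasurable

/-- **Re-continuisation costs at most `2/(αQ)`** (event form): for `x ← D_α` and an independent
`u ← U[-1/2,1/2)`, `|Pr[(⌊Qx⌉ + u)/Q ∈ A] - Pr[x ∈ A]| ≤ 2/(αQ)` for every measurable `A`. [folklore] -/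
theorem abs_jitterLaw_real_sub_le {α : ℝ} (hα : 0 < α) {A : Set ℝ} (hA : MeasurableSet A) :
    |(((gaussianReal 0 (widthVar α)).prod unitUniform).map (jitter Q)).real A -
        (gaussianReal 0 (widthVar α)).real A| ≤ 2 / (α * Q) := by
  set μ := gaussianReal 0 (widthVar α) with hμ
  have hJ := jitterLaw_apply Q μ hA
  have hM := measure_eq_tsum_inter_cell Q μ hA
  have hcmp := fun k => cell_compare Q hα k hA
  have hosc := tsum_cellOsc_le Q hα
  rw [measureReal_def, measureReal_def]
  refine abs_toReal_sub_toReal_le (measure_ne_top _ _) (measure_ne_top _ _) (by positivity) ?_ ?_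
  · rw [hJ, hM, ← ENNReal.ofReal_toReal (a := ENNReal.ofReal (2 / (α * Q))) ENNReal.ofReal_ne_top,
      ENNReal.toReal_ofReal (by positivity)]
    calc ∑' k : ℤ, μ (cellIndex Q ⁻¹' {k}) * ((Q : ℝ≥0∞) * volume (A ∩ cellIndex Q ⁻¹' {k}))
        ≤ ∑' k : ℤ, (μ (A ∩ cellIndex Q ⁻¹' {k}) + cellOsc Q α k) := ENNReal.tsum_le_tsum fun k => (hcmp k).1
      _ = ∑' k : ℤ, μ (A ∩ cellIndex Q ⁻¹' {k}) + ∑' k : ℤ, cellOsc Q α k := ENNReal.tsum_add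
      _ ≤ ∑' k : ℤ, μ (A ∩ cellIndex Q ⁻¹' {k}) + ENNReal.ofReal (2 / (α * Q)) := add_le_add le_rfl hosc
  · rw [hJ, hM, ← ENNReal.ofReal_toReal (a := ENNReal.ofReal (2 / (α * Q))) ENNReal.ofReal_ne_top,
      ENNReal.toReal_ofReal (by positivity)]
    calc ∑' k : ℤ, μ (A ∩ cellIndex Q ⁻¹' {k})
        ≤ ∑' k : ℤ, (μ (cellIndex Q ⁻¹' {k}) * ((Q : ℝ≥0∞) * volume (A ∩ cellIndex Q ⁻¹' {k})) + cellOsc Q α k) :=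
          ENNReal.tsum_le_tsum fun k => (hcmp k).2
      _ = ∑' k : ℤ, μ (cellIndex Q ⁻¹' {k}) * ((Q : ℝ≥0∞) * volume (A ∩ cellIndex Q ⁻¹' {k})) +
            ∑' k : ℤ, cellOsc Q α k := ENNReal.tsum_add
      _ ≤ _ := add_le_add le_rfl hosc

/-- **Re-continuisation costs at most `2/(αQ)`** (statistical distance): rounding a sample of
`D_α = N(0, α²/(2π))` to the grid `Q⁻¹ℤ` and jittering it uniformly within its cell moves its law by at
most `2/(αQ)`. This is the price of feeding samples with DISCRETISED noise `Ψ̄_α` (all that an oracle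
interface transmits) to a reduction written for the continuous `Ψ_α`, negligible when `Q` is
exponential in the dimension (BLPRS's chain in dimension `√n` with `q = 2^{√n/2}`). [folklore] -/
theorem statDist_jitterLaw_gaussian_le {α : ℝ} (hα : 0 < α) :
    statDist (((gaussianReal 0 (widthVar α)).prod unitUniform).map (jitter Q)) (gaussianReal 0 (widthVar α)) ≤
      2 / (α * Q) :=
  statDist_le_of_forall_abs_sub_le (by positivity) fun _ hA => abs_jitterLaw_real_sub_le Q hα hA

end LWE

end Literature.Computability.Cryptography

end
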